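import Summits.AtomisticToContinuum.Crystallization.Theorems.PricedLinkCensusTruncatedCensusGapGapOfPeriodicPricing

/-!
# The ring census gap (class (R) of line `birth`) follows from its PERIODIC form

Helper for the stub `stub_ringCensusGap` of the census split `Cruxes/TruncatedCensusGap/Lines/birth.lean`
of the crux `PricedLinkCensus.TruncatedCensusGap` (item stmt-AtomisticToContinuum-14230): the
`R`-twin of the landed `truncatedCensusGap_of_periodicPricing`
(`…TruncatedCensusGapGapOfPeriodicPricing.lean`, p127773).

Write `V_χ r = min 1 (max 0 (4 - 2r)) · V_LJ r` (range `2`), `e_χ* = ⨅_Q e_χ(Q)` over periodic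
configurations of `ℝ³`, and call a site RING-DEFECTIVE (class (R)) when it has exactly twelve
bonds in the scale-free bond graph at tolerance `1/100` and some bond at it has ring number `≠ 4`.

* `ringCensusGap_of_periodicRingPricing` — **periodic (R)-pricing implies the stub**: if every
  periodic configuration `Q` pays `κ > 0` per ring-defective MOTIF site (the predicate read in the
  infinite point set `Q.points`) above `e_χ*`, `κ · #R(Q) ≤ #F · (e_χ(Q) − e_χ*)`, then every
  finite injective `y` satisfies `N · e_χ* + κ · #R(y) ≤ E_χ(y)` — the registered signature of
  `stub_ringCensusGap` with that `κ`.  Proof: far periodisation `y + (8D+8)ℤ³`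
  (`ChargedEnergyGapNegative.periodiseFar`); the bond graph of the periodic point set restricted
  to the motif is the bond graph of `y` (`neighborSet_toPoint`, `ringNumber_toPoint`, landed and
  potential independent), so the ring-defective motif sites are exactly the ring-defective sites
  of `y` (`nat_card_ringDefective_periodiseFar`), while the energy per particle of the
  periodisation is EXACTLY `E_χ(y)/N` (`energyPerParticle_periodiseFar_eq_div`).  Configurations
  with `N ≤ 12` sites have no twelve-coordinated site at all (`nat_card_ringDefective_eq_zero_of_le`),
  and the cases `N ≤ 1` follow from the dimer instance `2 e_χ* ≤ -1/12` of the case `N = 2`.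

So the open content of `stub_ringCensusGap` is a statement of Blanc–Lewin's periodic universe:
"the excess energy density of a periodic `V_χ` configuration over the periodic infimum controls
its density of twelve-coordinated ring-defective sites" — finite-range periodic crystallization
with tetrahedral-frustration pricing (no named fact of the tree; see the line card
`Lines/sharp-m-potential-compactness.md`, CH-PRICE).  All `[folklore]` bookkeeping.
-/

noncomputable section

namespace Summit.AtomisticToContinuum.Crystallization.Theorems.PricedLinkCensusTruncatedCensusGap

open Literature.MathematicalPhysics.StatisticalMechanics Literature.Geometry.DiscreteGeometry
open Summit.AtomisticToContinuum.Crystallization.Theorems.ChargedEnergyGapNegative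

section RingPeriodicForm

variable {N : ℕ}

/-- A neighbour set misses the site itself, so it has fewer than `Nat.card ι` elements.
[folklore] -/
theorem ncard_neighborSet_lt_nat_card {ι X : Type*} [PseudoMetricSpace X] [Finite ι] (η : ℝ)
    (y : ι → X) (i : ι) : ((bondGraph η y).neighborSet i).ncard < Nat.card ι := by
  have hsub : (bondGraph η y).neighborSet i ⊆ {k | k ≠ i} := fun k hk =>
    ((bondGraph η y).ne_of_adj hk).symm
  have hlt : ({k | k ≠ i} : Set ι).ncard < Nat.card ι := by
    have : ({k | k ≠ i} : Set ι) = {i}ᶜ := by ext k; simp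
    rw [this, Set.ncard_compl, Set.ncard_singleton]
    have : 0 < Nat.card ι := Nat.card_pos_iff.2 ⟨⟨i⟩, inferInstance⟩
    omega
  exact (Set.ncard_le_ncard hsub (Set.toFinite _)).trans_lt hlt

/-- **With at most twelve sites no site is twelve-coordinated**, so a configuration of `N ≤ 12`
points has no ring-defective site. [folklore] -/
theorem nat_card_ringDefective_eq_zero_of_le (hN : N ≤ 12) (η : ℝ)
    (y : Fin N → EuclideanSpace ℝ (Fin 3)) :
    Nat.card {i : Fin N // ((bondGraph η y).neighborSet i).ncard = 12 ∧
      ∃ j ∈ (bondGraph η y).neighborSet i, ringNumber η y i j ≠ 4} = 0 := by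
  haveI : IsEmpty {i : Fin N // ((bondGraph η y).neighborSet i).ncard = 12 ∧
      ∃ j ∈ (bondGraph η y).neighborSet i, ringNumber η y i j ≠ 4} :=
    ⟨fun i => by
      have h := ncard_neighborSet_lt_nat_card η y i.1
      rw [Nat.card_eq_fintype_card, Fintype.card_fin] at h
      have h12 := i.2.1
      omega⟩
  exact Nat.card_of_isEmpty

/-- **Ring-defectiveness of motif points read in the far periodisation = in `y`** (`η ≤ 1`,
`y` injective, `N ≥ 2`): neighbour sets and ring numbers of motif points are transported by
`toPoint` (`neighborSet_toPoint`, `ringNumber_toPoint`). [folklore] -/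
theorem ringDefective_toPoint_iff {y : Fin N → E3} (hy : Function.Injective y) (hN : 0 < N)
    {η : ℝ} (hη1 : η ≤ 1) (hN2 : ∀ i : Fin N, ∃ j, j ≠ i) (i : Fin N) :
    (((bondGraph η (Subtype.val : (periodiseFar y hN).points → E3)).neighborSet
          (toPoint y hN i)).ncard = 12 ∧
        ∃ q ∈ (bondGraph η (Subtype.val : (periodiseFar y hN).points → E3)).neighborSet
          (toPoint y hN i),
          ringNumber η (Subtype.val : (periodiseFar y hN).points → E3) (toPoint y hN i) q ≠ 4) ↔
      (((bondGraph η y).neighborSet i).ncard = 12 ∧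
        ∃ j ∈ (bondGraph η y).neighborSet i, ringNumber η y i j ≠ 4) := by
  rw [neighborSet_toPoint hy hN hη1 hN2, Set.ncard_image_of_injective _ (toPoint_injective hy hN),
    Set.exists_mem_image]
  refine and_congr_right fun _ => exists_congr fun j => and_congr_right fun _ => ?_
  rw [ringNumber_toPoint hy hN hη1 hN2]

/-- **The far periodisation has exactly as many ring-defective motif sites as `y` has
ring-defective sites** (`η ≤ 1`, `y` injective, `N ≥ 2`). [folklore] -/
theorem nat_card_ringDefective_periodiseFar {y : Fin N → E3} (hy : Function.Injective y)
    (hN : 0 < N) {η : ℝ} (hη1 : η ≤ 1) (hN2 : ∀ i : Fin N, ∃ j, j ≠ i) :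
    Nat.card {x : (periodiseFar y hN).motif //
        ((bondGraph η (Subtype.val : (periodiseFar y hN).points → E3)).neighborSet
              ⟨x.1, (periodiseFar y hN).mem_points_of_mem_motif x.2⟩).ncard = 12 ∧
          ∃ q ∈ (bondGraph η (Subtype.val : (periodiseFar y hN).points → E3)).neighborSet
              ⟨x.1, (periodiseFar y hN).mem_points_of_mem_motif x.2⟩,
            ringNumber η (Subtype.val : (periodiseFar y hN).points → E3)
              ⟨x.1, (periodiseFar y hN).mem_points_of_mem_motif x.2⟩ q ≠ 4} =
      Nat.card {i : Fin N // ((bondGraph η y).neighborSet i).ncard = 12 ∧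
        ∃ j ∈ (bondGraph η y).neighborSet i, ringNumber η y i j ≠ 4} := by
  -- the R-predicate, in `y` and in the periodic point set
  set R : Fin N → Prop := fun i => ((bondGraph η y).neighborSet i).ncard = 12 ∧
    ∃ j ∈ (bondGraph η y).neighborSet i, ringNumber η y i j ≠ 4 with hR
  set Rp : (periodiseFar y hN).points → Prop := fun p =>
    ((bondGraph η (Subtype.val : (periodiseFar y hN).points → E3)).neighborSet p).ncard = 12 ∧
      ∃ q ∈ (bondGraph η (Subtype.val : (periodiseFar y hN).points → E3)).neighborSet p,
        ringNumber η (Subtype.val : (periodiseFar y hN).points → E3) p q ≠ 4 with hRp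
  have hiff : ∀ i : Fin N, Rp (toPoint y hN i) ↔ R i := fun i =>
    ringDefective_toPoint_iff hy hN hη1 hN2 i
  show Nat.card {x : (periodiseFar y hN).motif //
      Rp ⟨x.1, (periodiseFar y hN).mem_points_of_mem_motif x.2⟩} = Nat.card {i : Fin N // R i}
  let f : {i : Fin N // R i} →
      {x : (periodiseFar y hN).motif // Rp ⟨x.1, (periodiseFar y hN).mem_points_of_mem_motif x.2⟩} :=
    fun i => ⟨⟨y i.1, mem_motif_periodiseFar y hN i.1⟩, (hiff i.1).2 i.2⟩
  have hf : Function.Bijective f := by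
    constructor
    · intro a b hab
      have : y a.1 = y b.1 :=
        congrArg (fun z => ((z.1 : (periodiseFar y hN).motif) : E3)) hab
      exact Subtype.ext (hy this)
    · rintro ⟨⟨v, hv⟩, hc⟩
      have hv' := hv
      rw [motif_periodiseFar] at hv'
      obtain ⟨i, -, rfl⟩ := Finset.mem_image.1 hv'
      exact ⟨⟨i, (hiff i).1 hc⟩, rfl⟩
  exact (Nat.card_congr (Equiv.ofBijective f hf)).symm

end RingPeriodicForm

/-- **Periodic (R)-pricing for `V_χ` implies the ring census gap** (the registered statement of
`stub_ringCensusGap`, with the same `κ`).  If every periodic configuration `Q` of `ℝ³` pays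
`κ > 0` per ring-defective motif site (twelve bonds and a bond of ring number `≠ 4` in the
scale-free bond graph of `Q.points` at tolerance `1/100`) above `e_χ*`, then every finite
injective configuration satisfies `N · e_χ* + κ · #R(y) ≤ E_χ(y)` (far periodisation for
`N ≥ 13`; for `N ≤ 12` there is no ring-defective site and the `κ = 0` inequality follows from
the far periodisation for `N ≥ 2`, from the dimer instance `2 e_χ* ≤ -1/12` for `N ≤ 1`).
[folklore] -/
theorem ringCensusGap_of_periodicRingPricing : (∃ κ : ℝ, 0 < κ ∧ ∀ Q : Literature.MathematicalPhysics.StatisticalMechanics.PeriodicConfiguration 3, κ * (Nat.card {x : Q.motif // ((Literature.Geometry.DiscreteGeometry.bondGraph (1 / 100 : ℝ) (Subtype.val : Q.points → EuclideanSpace ℝ (Fin 3))).neighborSet ⟨x.1, Q.mem_points_of_mem_motif x.2⟩).ncard = 12 ∧ ∃ q ∈ (Literature.Geometry.DiscreteGeometry.bondGraph (1 / 100 : ℝ) (Subtype.val : Q.points → EuclideanSpace ℝ (Fin 3))).neighborSet ⟨x.1, Q.mem_points_of_mem_motif x.2⟩, Literature.Geometry.DiscreteGeometry.ringNumber (1 /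 100 : ℝ) (Subtype.val : Q.points → EuclideanSpace ℝ (Fin 3)) ⟨x.1, Q.mem_points_of_mem_motif x.2⟩ q ≠ 4} : ℝ) ≤ (Q.motif.card : ℝ) * (Q.energyPerParticle (fun r => min 1 (max 0 (4 - 2 * r)) * Literature.MathematicalPhysics.StatisticalMechanics.lennardJones r) - ⨅ Q' : Literature.MathematicalPhysics.StatisticalMechanics.PeriodicConfiguration 3, Q'.energyPerParticle (fun r => min 1 (max 0 (4 - 2 * r)) * Literature.MathematicalPhysics.StatisticalMechanics.lennardJones r))) → ∃ κ : ℝ, 0 < κ ∧ ∀ (N : ℕ) (y : Fin N → EuclideanSpace ℝ (Fin 3)), Function.Injective y → (N : ℝ) * (⨅ Q : Literature.MathematicalPhysics.StatisticalMechanics.PeriodicConfiguration 3, Q.energyPerParticle (fun r => min 1 (max 0 (4 - 2 * r)) * Literature.MathematicalPhysics.StatisticalMechanics.lennardJones r)) + κ * (Nat.card {i : Fin N // ((Literature.Geometry.DiscreteGeometry.bondGraph (1 / 100 : ℝ) y).neighborSet i).ncard = 12 ∧ ∃ j ∈ (Literature.Geometry.DiscreteGeometry.bondGraph (1 / 100 :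 ℝ) y).neighborSet i, Literature.Geometry.DiscreteGeometry.ringNumber (1 / 100 : ℝ) y i j ≠ 4} : ℝ) ≤ Literature.MathematicalPhysics.StatisticalMechanics.interactionEnergy (fun r => min 1 (max 0 (4 - 2 * r)) * Literature.MathematicalPhysics.StatisticalMechanics.lennardJones r) y := by
  rintro ⟨κ, hκ, h⟩
  -- `N ≥ 2`: the far periodisation
  have main : ∀ {N : ℕ}, 2 ≤ N → ∀ (y : Fin N → E3), Function.Injective y →
      (N : ℝ) * (⨅ Q : PeriodicConfiguration 3,
          Q.energyPerParticle (fun r => min 1 (max 0 (4 - 2 * r)) * lennardJones r)) +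
        κ * (Nat.card {i : Fin N // ((bondGraph (1 / 100 : ℝ) y).neighborSet i).ncard = 12 ∧
          ∃ j ∈ (bondGraph (1 / 100 : ℝ) y).neighborSet i, ringNumber (1 / 100 : ℝ) y i j ≠ 4} : ℝ) ≤
        interactionEnergy (fun r => min 1 (max 0 (4 - 2 * r)) * lennardJones r) y := by
    intro N hN y hy
    have hN0 : 0 < N := by omega
    have hN2 : ∀ i : Fin N, ∃ j, j ≠ i := exists_ne_of_two_le hN
    have hp := h (periodiseFar y hN0)
    rw [nat_card_ringDefective_periodiseFar hy hN0 (by norm_num) hN2] at hp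
    have hcard : (((periodiseFar y hN0).motif.card : ℕ) : ℝ) = N := by
      rw [motif_periodiseFar, Finset.card_image_of_injective _ hy, Finset.card_univ,
        Fintype.card_fin]
    have he : (periodiseFar y hN0).energyPerParticle
        (fun r => min 1 (max 0 (4 - 2 * r)) * lennardJones r) =
        interactionEnergy (fun r => min 1 (max 0 (4 - 2 * r)) * lennardJones r) y / N :=
      energyPerParticle_periodiseFar_eq_div truncLJ_eq_zero_of_two_le (by norm_num) hy hN0
    rw [hcard, he, mul_sub] at hp
    have hNr : (0 : ℝ) < N := by exact_mod_cast hN0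
    have hmul : (N : ℝ) *
        (interactionEnergy (fun r => min 1 (max 0 (4 - 2 * r)) * lennardJones r) y / N) =
        interactionEnergy (fun r => min 1 (max 0 (4 - 2 * r)) * lennardJones r) y := by
      field_simp
    linarith
  -- the dimer instance: `2 e_χ* ≤ -1/12`
  have hdimer : 2 * (⨅ Q : PeriodicConfiguration 3,
      Q.energyPerParticle (fun r => min 1 (max 0 (4 - 2 * r)) * lennardJones r)) ≤ -1 / 12 := by
    have h2 := main le_rfl _ injective_pair_zero_single
    rw [nat_card_ringDefective_eq_zero_of_le (by norm_num), interactionEnergy_truncLJ_pair] at h2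
    push_cast at h2
    linarith
  refine ⟨κ, hκ, fun N y hy => ?_⟩
  rcases Nat.lt_or_ge N 2 with hN | hN
  · have h0 := nat_card_ringDefective_eq_zero_of_le (show N ≤ 12 by omega) (1 / 100 : ℝ) y
    interval_cases N
    · rw [h0, interactionEnergy_of_subsingleton]
      simp
    · rw [h0, interactionEnergy_of_subsingleton]
      push_cast
      linarith
  · exact main hN y hy

end Summit.AtomisticToContinuum.Crystallization.Theorems.PricedLinkCensusTruncatedCensusGap

end
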